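import Literature.Probability.RandomPlanarGeometry.HexSAWArmchairWallBridges
import HarnessLib

/-!
# Every even number of wall visits from `4` to `2p` is ATTAINED by an armchair wall bridge of length `4p − 3`

Topic `Literature/Probability/RandomPlanarGeometry` (lane «pcv-sawmu», rotated-door lineage, a-p6 g14; continues
`HexSAWArmchairWallBridges.lean` — armchair wall bridges `Arm.wb n`, wall visits `Arm.visits`, the surface zig-zag `Arm.zz` with
`zzWalk_mem_wb` / `zz_adj`).

THE CONSTRUCTION.  For `k, t ≥ 0` the walk `zzEx k t` of length `n = 4k + 4t + 5 = 4(k+t+2) − 3`: the surface zig-zag `zz` for the times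
`0 … 4k+1` (ending at the top `(0, 2k+1)` of its `(k+1)`-st dimer, `2k + 2` wall visits), then the TRANSLATED zig-zag `(1, 2k+1) + zz s`,
`s = 0 … 4t+1`, which climbs in the columns `X = 1, 2` without touching the wall (the translation vector has even parity, so brick-wall
bonds are preserved), ending at `(1, 2k+2+2t)`, and finally the closing surface dimer `(0, 2k+2+2t) → (0, 2k+3+2t)` (two more visits).
It is a wall bridge of length `4(k+t+2) − 3` with exactly `2k + 4 = 2(k+2)` wall visits ("walks which step along the surface" for a
while, then along the next column [Beaton2014RotatedHoneycomb, §3.1, arXiv v3 p. 14; §2 Fig. 1 for the armchair surface]).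

* `Arm.zzEx`, `Arm.zzEx_mem_wb : zzEx k t ∈ wb (4k+4t+5)`, `Arm.visits_zzEx : visits (4k+4t+5) (zzEx k t) = 2k + 4`;
* ★ `Arm.exists_mem_wb_visits_eq : 2 ≤ j → j ≤ p → ∃ ω ∈ wb (4p − 3), visits (4p − 3) ω = 2j` — together with the lane's parity law
  (`HexSAWArmchairWallBridgeVisitParity.lean`: visits even, `≥ 4` for length `≥ 3`) and the top-density uniqueness
  (`HexSAWRotSurfaceDensityFunction.lean` §6: `≤ 2p`, attained only by `zz`), the visit SPECTRUM of the armchair wall bridges of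
  length `4p − 3 ≥ 5` is EXACTLY `{4, 6, …, 2p}` (those two modules are not imported here; this file is the existence half).
HONEST LABEL: LANE LEMMA (XS–S), an explicit lattice construction; not a printed statement.
-/

noncomputable section

open Finset Function
open Literature.Probability.LatticeModels Literature.Probability.Percolation SimpleGraph

namespace Literature.Probability.RandomPlanarGeometry.SAW.HexBW.Arm

variable {n : ℕ}

/-- Brick-wall bonds are invariant under translation by a vector of EVEN parity (`v 0 + v 1` even).
[cite: EntingJensen2009, §7.4.2, Fig. 7.10 (brickwork form)] -/
theorem adj_add_of_even (v : Site 2) (hv : (v 0 + v 1) % 2 = 0) {x z : Site 2} (h : brickWallGraph.Adj x z) :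
    brickWallGraph.Adj (v + x) (v + z) := by
  rw [brickWallGraph_adj_coord] at h ⊢
  simp only [Pi.add_apply]
  omega

/-- The base point `(1, 2k+1)` of the translated zig-zag. [cite: Beaton2014RotatedHoneycomb, §2 (Fig. 1)] -/
def exBase (k : ℕ) : Site 2 := fun j => if j = 0 then 1 else (2 * k + 1 : ℕ)

/-- Coordinates of the base point. [cite: Beaton2014RotatedHoneycomb, §2 (Fig. 1)] -/
theorem exBase_apply_zero (k : ℕ) : exBase k 0 = 1 := by simp [exBase]

/-- Coordinates of the base point. [cite: Beaton2014RotatedHoneycomb, §2 (Fig. 1)] -/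
theorem exBase_apply_one (k : ℕ) : exBase k 1 = (2 * k + 1 : ℕ) := by simp [exBase]

/-- The top of the closing dimer's lower vertex `(0, 2k+2+2t)` and the endpoint `(0, 2k+3+2t)`, as one function of the height.
[cite: Beaton2014RotatedHoneycomb, §2 (Fig. 1)] -/
def wallPt (h : ℕ) : Site 2 := fun j => if j = 0 then 0 else (h : ℤ)

/-- Coordinates of `wallPt`. [cite: Beaton2014RotatedHoneycomb, §2 (Fig. 1)] -/
theorem wallPt_apply_zero (h : ℕ) : wallPt h 0 = 0 := by simp [wallPt]

/-- Coordinates of `wallPt`. [cite: Beaton2014RotatedHoneycomb, §2 (Fig. 1)] -/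
theorem wallPt_apply_one (h : ℕ) : wallPt h 1 = (h : ℤ) := by simp [wallPt]

/-- **The excursion family `zzEx k t`** (length `4k + 4t + 5`): surface zig-zag for `4k + 1` steps, translated zig-zag in the columns
`X = 1, 2` for `4t + 1` steps, closing dimer; frozen after its length. [cite: Beaton2014RotatedHoneycomb, §3.1 (arXiv v3 p. 14: walks which step along the surface) and §2 (Fig. 1)] -/
def zzEx (k t : ℕ) (i : ℕ) : Site 2 :=
  if i ≤ 4 * k + 1 then zz i
  else if i ≤ 4 * k + 4 * t + 3 then exBase k + zz (i - (4 * k + 2))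
  else if i = 4 * k + 4 * t + 4 then wallPt (2 * k + 2 * t + 2)
  else wallPt (2 * k + 2 * t + 3)

/-- Phase 1 (surface zig-zag). [cite: Beaton2014RotatedHoneycomb, §3.1 (arXiv v3 p. 14)] -/
theorem zzEx_of_le {k t i : ℕ} (hi : i ≤ 4 * k + 1) : zzEx k t i = zz i := by
  simp [zzEx, hi]

/-- Phase 2 (translated zig-zag). [cite: Beaton2014RotatedHoneycomb, §2 (Fig. 1)] -/
theorem zzEx_of_mid {k t i : ℕ} (h1 : 4 * k + 2 ≤ i) (h2 : i ≤ 4 * k + 4 * t + 3) :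
    zzEx k t i = exBase k + zz (i - (4 * k + 2)) := by
  have : ¬ i ≤ 4 * k + 1 := by omega
  simp [zzEx, this, h2]

/-- Phase 3 (lower vertex of the closing dimer). [cite: Beaton2014RotatedHoneycomb, §2 (Fig. 1)] -/
theorem zzEx_of_eq {k t : ℕ} : zzEx k t (4 * k + 4 * t + 4) = wallPt (2 * k + 2 * t + 2) := by
  have h1 : ¬ 4 * k + 4 * t + 4 ≤ 4 * k + 1 := by omega
  have h2 : ¬ 4 * k + 4 * t + 4 ≤ 4 * k + 4 * t + 3 := by omega
  simp [zzEx, h1, h2]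

/-- Phase 4 (the endpoint, frozen). [cite: Beaton2014RotatedHoneycomb, §2 (Fig. 1)] -/
theorem zzEx_of_ge {k t i : ℕ} (hi : 4 * k + 4 * t + 5 ≤ i) : zzEx k t i = wallPt (2 * k + 2 * t + 3) := by
  have h1 : ¬ i ≤ 4 * k + 1 := by omega
  have h2 : ¬ i ≤ 4 * k + 4 * t + 3 := by omega
  have h3 : i ≠ 4 * k + 4 * t + 4 := by omega
  simp [zzEx, h1, h2, h3]

/-- The `X`-coordinate of `zzEx` along the four phases. [cite: Beaton2014RotatedHoneycomb, §2 (Fig. 1)] -/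
theorem zzEx_apply_zero (k t i : ℕ) :
    zzEx k t i 0 = if i ≤ 4 * k + 1 then (if i % 4 = 2 ∨ i % 4 = 3 then 1 else 0)
      else if i ≤ 4 * k + 4 * t + 3 then (if (i - (4 * k + 2)) % 4 = 2 ∨ (i - (4 * k + 2)) % 4 = 3 then 2 else 1)
      else 0 := by
  by_cases h1 : i ≤ 4 * k + 1
  · rw [zzEx_of_le h1, if_pos h1, zz_apply_zero]
  · rw [if_neg h1]
    by_cases h2 : i ≤ 4 * k + 4 * t + 3
    · rw [zzEx_of_mid (by omega) h2, if_pos h2, Pi.add_apply, exBase_apply_zero, zz_apply_zero]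
      split_ifs <;> norm_num
    · rw [if_neg h2]
      rcases Nat.lt_or_ge i (4 * k + 4 * t + 5) with h3 | h3
      · rw [show i = 4 * k + 4 * t + 4 by omega, zzEx_of_eq, wallPt_apply_zero]
      · rw [zzEx_of_ge h3, wallPt_apply_zero]

/-- The `Y`-coordinate of `zzEx` along the four phases. [cite: Beaton2014RotatedHoneycomb, §2 (Fig. 1)] -/
theorem zzEx_apply_one (k t i : ℕ) :
    zzEx k t i 1 = if i ≤ 4 * k + 1 then (((i + 1) / 2 : ℕ) : ℤ)
      else if i ≤ 4 * k + 4 * t + 3 then ((2 * k + 1 : ℕ) : ℤ) + (((i - (4 * k + 2) + 1) / 2 : ℕ) : ℤ)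
      else if i = 4 * k + 4 * t + 4 then ((2 * k + 2 * t + 2 : ℕ) : ℤ) else ((2 * k + 2 * t + 3 : ℕ) : ℤ) := by
  by_cases h1 : i ≤ 4 * k + 1
  · rw [zzEx_of_le h1, if_pos h1, zz_apply_one]
  · rw [if_neg h1]
    by_cases h2 : i ≤ 4 * k + 4 * t + 3
    · rw [zzEx_of_mid (by omega) h2, if_pos h2, Pi.add_apply, exBase_apply_one, zz_apply_one]
    · rw [if_neg h2]
      by_cases h3 : i = 4 * k + 4 * t + 4
      · rw [if_pos h3, h3, zzEx_of_eq, wallPt_apply_one]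
      · rw [if_neg h3, zzEx_of_ge (by omega), wallPt_apply_one]

/-- The base point has even parity (`1 + (2k+1)`), so translating `zz` by it preserves brick-wall bonds. [cite: EntingJensen2009, §7.4.2, Fig. 7.10] -/
theorem exBase_even (k : ℕ) : (exBase k 0 + exBase k 1) % 2 = 0 := by
  rw [exBase_apply_zero, exBase_apply_one]; push_cast; omega

/-- **`zzEx k t` is a brick-wall walk**: consecutive vertices are neighbours (all `i < 4k+4t+5`).
[cite: Beaton2014RotatedHoneycomb, §2 (Fig. 1: the armchair surface); EntingJensen2009, §7.4.2, Fig. 7.10] -/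
theorem zzEx_adj (k t : ℕ) {i : ℕ} (hi : i < 4 * k + 4 * t + 5) : brickWallGraph.Adj (zzEx k t i) (zzEx k t (i + 1)) := by
  rcases Nat.lt_or_ge (i + 1) (4 * k + 2) with h1 | h1
  · -- phase 1
    rw [zzEx_of_le (by omega), zzEx_of_le (by omega)]; exact zz_adj i
  rcases eq_or_lt_of_le h1 with h2 | h2
  · -- the step off the wall at time 4k+1 → 4k+2
    have hi1 : i = 4 * k + 1 := by omega
    subst hi1
    rw [zzEx_of_le le_rfl, zzEx_of_mid (by omega) (by omega), Nat.sub_self]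
    have hm : (4 * k + 1) % 4 = 1 := by omega
    refine adj_of_horiz ?_ (Or.inl ?_)
    · rw [Pi.add_apply, exBase_apply_one, zz_apply_one, zz_apply_one]; push_cast; omega
    · rw [Pi.add_apply, exBase_apply_zero, zz_apply_zero, zz_apply_zero, if_neg (by omega), if_neg (by omega)]; ring
  rcases Nat.lt_or_ge (i + 1) (4 * k + 4 * t + 4) with h3 | h3
  · -- phase 2: translated zig-zag
    rw [zzEx_of_mid (by omega) (by omega), zzEx_of_mid (by omega) (by omega),
      show i + 1 - (4 * k + 2) = i - (4 * k + 2) + 1 by omega]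
    exact adj_add_of_even _ (exBase_even k) (zz_adj _)
  rcases eq_or_lt_of_le h3 with h4 | h4
  · -- back to the wall: (1, 2k+2+2t) → (0, 2k+2+2t)
    have hi1 : i = 4 * k + 4 * t + 3 := by omega
    subst hi1
    rw [zzEx_of_mid (by omega) le_rfl, zzEx_of_eq, show 4 * k + 4 * t + 3 - (4 * k + 2) = 4 * t + 1 by omega]
    have hm : ¬ ((4 * t + 1) % 4 = 2 ∨ (4 * t + 1) % 4 = 3) := by omega
    refine adj_of_horiz ?_ (Or.inr ?_)
    · rw [wallPt_apply_one, Pi.add_apply, exBase_apply_one, zz_apply_one]; push_cast; omega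
    · rw [wallPt_apply_zero, Pi.add_apply, exBase_apply_zero, zz_apply_zero, if_neg hm]; ring
  · -- the closing dimer
    have hi1 : i = 4 * k + 4 * t + 4 := by omega
    subst hi1
    rw [zzEx_of_eq, zzEx_of_ge le_rfl]
    refine adj_of_up ?_ ?_ ?_
    · rw [wallPt_apply_zero, wallPt_apply_zero]
    · rw [wallPt_apply_one, wallPt_apply_one]; push_cast; ring
    · rw [wallPt_apply_zero, wallPt_apply_one]; omega

/-- **`zzEx k t` is self-avoiding** on `[0, 4k+4t+5]` (the three pieces live in disjoint regions: the wall zig-zag below the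
level `2k+1`, the translated zig-zag in the columns `1, 2` above it, the closing dimer on the wall above everything).
[cite: Beaton2014RotatedHoneycomb, §2 (Fig. 1)] -/
theorem zzEx_injOn (k t : ℕ) : Set.InjOn (zzEx k t) {i | i ≤ 4 * k + 4 * t + 5} := by
  intro i hi j hj hij
  simp only [Set.mem_setOf_eq] at hi hj
  rw [site_two_eq_iff, zzEx_apply_zero, zzEx_apply_zero, zzEx_apply_one, zzEx_apply_one] at hij
  obtain ⟨h0, h1⟩ := hij
  split_ifs at h0 h1 <;> omega

/-- ★ **`zzEx k t` is an armchair wall bridge of length `4k + 4t + 5`.**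
[cite: Beaton2014RotatedHoneycomb, §3.1 (arXiv v3 pp. 11–12: unfolded walks; p. 14: walks which step along the surface) and §2 (Fig. 1)] -/
theorem zzEx_mem_wb (k t : ℕ) : zzEx k t ∈ wb (4 * k + 4 * t + 5) := by
  have hn0 : zzEx k t (4 * k + 4 * t + 5) 0 = 0 := by rw [zzEx_of_ge le_rfl, wallPt_apply_zero]
  have hn1 : zzEx k t (4 * k + 4 * t + 5) 1 = ((2 * k + 2 * t + 3 : ℕ) : ℤ) := by rw [zzEx_of_ge le_rfl, wallPt_apply_one]
  refine mem_wb.2 ⟨mem_arches.2 ⟨mem_hp.2 ⟨mem_saws_iff.2 ⟨?_, fun i hi => ?_, fun i hi => zzEx_adj k t hi,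
    zzEx_injOn k t⟩, fun i _ => ?_⟩, hn0⟩, ?_, fun i hi1 hi => ?_⟩
  · rw [site_two_eq_iff, zzEx_apply_zero, zzEx_apply_one]
    refine ⟨?_, ?_⟩ <;> simp
  · rw [zzEx_of_ge hi, zzEx_of_ge le_rfl]
  · rw [zzEx_apply_zero]; split_ifs <;> norm_num
  · rw [hn1]; exact_mod_cast Nat.succ_pos _
  · rw [hn1, zzEx_apply_one]
    split_ifs <;> constructor <;> omega

/-- Wall visits of the prefix (the surface zig-zag): `visits m = 2⌊m/4⌋ + (1 if m ≡ 0, else 2)` for `m ≤ 4k + 1`.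
[cite: Beaton2014RotatedHoneycomb, §3.1 (arXiv v3 p. 11: "occupying m vertices in the surface")] -/
theorem visits_zzEx_prefix (k t : ℕ) :
    ∀ m ≤ 4 * k + 1, visits m (zzEx k t) = 2 * (m / 4) + (if m % 4 = 0 then 1 else 2) := by
  intro m
  induction m with
  | zero =>
      intro _
      rw [visits_zero, zzEx_apply_zero]
      simp
  | succ m ih =>
      intro hm
      rw [visits_succ, ih (by omega), zzEx_apply_zero, if_pos hm]
      split_ifs <;> omega

/-- ★ **`zzEx k t` has exactly `2k + 4` wall visits**: `2k + 2` on the surface zig-zag, none on the translated zig-zag, `2` on the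
closing dimer. [cite: Beaton2014RotatedHoneycomb, §3.1 (arXiv v3 p. 11: "occupying m vertices in the surface")] -/
theorem visits_zzEx (k t : ℕ) : visits (4 * k + 4 * t + 5) (zzEx k t) = 2 * k + 4 := by
  have h1 : visits (4 * k + 1) (zzEx k t) = 2 * k + 2 := by
    rw [visits_zzEx_prefix k t _ le_rfl]
    have e1 : (4 * k + 1) / 4 = k := by omega
    have e2 : (4 * k + 1) % 4 = 1 := by omega
    rw [e1, e2]; norm_num
  have h2 : visits (4 * k + 1 + (4 * t + 2)) (zzEx k t) = visits (4 * k + 1) (zzEx k t) := by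
    refine visits_add_eq_left fun j hj1 hj => ?_
    rw [zzEx_apply_zero, if_neg (by omega), if_pos (by omega)]
    split_ifs <;> norm_num
  rw [show 4 * k + 1 + (4 * t + 2) = 4 * k + 4 * t + 3 by ring] at h2
  have e4 : visits (4 * k + 4 * t + 4) (zzEx k t) = visits (4 * k + 4 * t + 3) (zzEx k t) + 1 := by
    rw [visits_succ, zzEx_of_eq, wallPt_apply_zero, if_pos rfl]
  have e5 : visits (4 * k + 4 * t + 5) (zzEx k t) = visits (4 * k + 4 * t + 4) (zzEx k t) + 1 := by
    rw [visits_succ, zzEx_of_ge le_rfl, wallPt_apply_zero, if_pos rfl]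
  rw [e5, e4, h2, h1]

/-- ★★ **Every even number of visits from `4` to `2p` is attained** by an armchair wall bridge of length `4p − 3` (`2 ≤ j ≤ p`): take
`zzEx (j − 2) (p − j)`. [cite: Beaton2014RotatedHoneycomb, §3.1 (arXiv v3 pp. 11–14) and §2 (Fig. 1)] -/
theorem exists_mem_wb_visits_eq {p j : ℕ} (hj : 2 ≤ j) (hjp : j ≤ p) :
    ∃ ω ∈ wb (4 * p - 3), visits (4 * p - 3) ω = 2 * j := by
  refine ⟨zzEx (j - 2) (p - j), ?_, ?_⟩
  · have e : 4 * p - 3 = 4 * (j - 2) + 4 * (p - j) + 5 := by omega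
    rw [e]; exact zzEx_mem_wb _ _
  · have e : 4 * p - 3 = 4 * (j - 2) + 4 * (p - j) + 5 := by omega
    rw [e, visits_zzEx]; omega

/-- The number of armchair wall bridges of length `4p − 3` with exactly `2j` wall visits is POSITIVE for `2 ≤ j ≤ p`.
[cite: Beaton2014RotatedHoneycomb, §3.1 (arXiv v3 p. 11: c_n^+(m))] -/
theorem card_filter_visits_pos {p j : ℕ} (hj : 2 ≤ j) (hjp : j ≤ p) :
    0 < #((wb (4 * p - 3)).filter fun ω => visits (4 * p - 3) ω = 2 * j) := by
  obtain ⟨ω, hω, hv⟩ := exists_mem_wb_visits_eq hj hjp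
  exact Finset.card_pos.2 ⟨ω, Finset.mem_filter.2 ⟨hω, hv⟩⟩

end Literature.Probability.RandomPlanarGeometry.SAW.HexBW.Arm

end
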